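import Mathlib
import HarnessLib
import Literature.Analysis.FluidPDE.VectorCalculus
import Literature.Analysis.FluidPDE.WholeSpaceIBP
import Literature.Analysis.FunctionSpaces.SobolevDomain
import Summits.AnomalousDissipation.AnomalousDissipation.Theorems.PointSinkConeDesingularisationStubDssFluxRigidity

/-!
# Stub `stub_c1ConeFluxless` — crux `PointSink.ConeDesingularisation` (stmt-AnomalousDissipation-19034), line `Sketch`

**C¹ DSS CONES ARE FLUXLESS** (line `Sketch`, tools). Let `(V, P)` be a velocity–pressure pair
on `ℝ³ ∖ {0}` which is `C¹` off the origin, `(-2/3, -4/3)`-discretely self-similar with factor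
`λ > 1` (`V (λx) = λ^{-2/3} V x`, `P (λx) = λ^{-4/3} P x`), and solves the steady Euler system
classically off the origin (`(V·∇)V + ∇P = 0`, `div V = 0`). Then the radial energy-flux log-mean
vanishes: `∫_{1<|x|<λ} H ⟪V,x⟫/|x|² = 0`, `H = ½|V|² + P` the Bernoulli head. This is
R. Shvydkoy, *Homogeneous solutions to the 3D Euler system*, Trans. AMS 370 (2018)
(arXiv:1510.03378), Lemma 6.1 (`C¹` homogeneous profiles are fluxless) in DSS generality; hence the
crux's hypothesis `PointFluxCone` has no `C¹` witness.

**Proof.** `C¹` off the origin and classical Euler give the Bernoulli law along streamlines,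
`DH(x)(V x) = ⟪DV(x)(V x) + ∇P(x), V x⟫ = 0`, so the head is RENORMALISED: for every `C¹`
function `β` and every test function `θ` supported off the origin the field
`w = θ β(H) V` is `C¹` with compact support on the whole space (the cut-off `θ` kills the
singularity), `div w = β(H) ⟪V, ∇θ⟫ + θ (β'(H) DH(V) + β(H) div V) = β(H) ⟪V, ∇θ⟫`, and the
boundary-free divergence theorem (`integral_divergence_eq_zero`) gives `∫ β(H) ⟪V, ∇θ⟫ = 0`.
Continuity off the origin supplies measurability, local integrability and integrability of the
flux density on the compact shell, and the landed DSS flux rigidity `stub_dssFluxRigidity`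
(lemma D1) concludes. [folklore + Shvydkoy 2018, Lemma 6.1]
-/

noncomputable section

-- `Summit.<Summit>.<Problem>`: single-conjunct summit, the duplicate namespace is mandated (CONVENTIONS §2).
set_option linter.dupNamespace false

namespace Summit.AnomalousDissipation.AnomalousDissipation.Theorems

open MeasureTheory Filter Topology Set
open Literature.Analysis.FunctionSpaces Literature.Analysis.FluidPDE

/-- Points / vector values of `ℝ³`. -/
local notation "E³" => EuclideanSpace ℝ (Fin 3)

/-! ### Globalising fields that are `C¹` off the origin by a cut-off -/

/-- A test function supported off the origin times a field that is `C¹` off the origin is a `C¹`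
field on the whole space: near a point of `tsupport θ` (which avoids `0`) it is a product of `C¹`
functions, and off `tsupport θ` it vanishes identically near the point. -/
theorem c1Cone_contDiff_smul {θ : E³ → ℝ} {G : E³ → E³}
    (hθ : IsTestFunctionOn ⟨{x : E³ | x ≠ 0}, isOpen_ne⟩ θ)
    (hG : ∀ x : E³, x ≠ 0 → ContDiffAt ℝ 1 G x) :
    ContDiff ℝ 1 fun y => θ y • G y := by
  refine contDiff_iff_contDiffAt.2 fun x => ?_
  by_cases hx : x ∈ tsupport θ
  · have hx0 : x ≠ 0 := hθ.tsupport_subset hx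
    have hθ1 : ContDiff ℝ 1 θ := hθ.contDiff.of_le (by exact_mod_cast le_top)
    exact hθ1.contDiffAt.fun_smul (hG x hx0)
  · have hev : (fun y => θ y • G y) =ᶠ[𝓝 x] fun _ => 0 := by
      filter_upwards [notMem_tsupport_iff_eventuallyEq.mp hx] with y hy
      simp [hy]
    exact (contDiffAt_const (c := (0 : E³))).congr_of_eventuallyEq hev

/-! ### The pointwise divergence of `θ g V` -/

/-- Leibniz twice: at a point where `θ`, `g`, `V` are differentiable, `div V = 0` and
`Dg(V) = 0`, the divergence of `θ (g V)` is `g ⟪V, ∇θ⟫`. -/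
theorem c1Cone_divergence_smul_smul {θ g : E³ → ℝ} {V : E³ → E³} {x : E³}
    (hθ : DifferentiableAt ℝ θ x) (hg : DifferentiableAt ℝ g x) (hV : DifferentiableAt ℝ V x)
    (hdiv : VectorCalculus.divergence V x = 0) (hgV : fderiv ℝ g x (V x) = 0) :
    VectorCalculus.divergence (fun y => θ y • (g y • V y)) x =
      g x * inner ℝ (V x) (gradient θ x) := by
  rw [divergence_smul_apply (u := fun y => g y • V y) hθ (hg.fun_smul hV),
    divergence_smul_apply hg hV, hdiv, radialFlux_inner_gradient g x (V x), hgV,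
    real_inner_smul_left]
  ring

/-- Off the topological support of `θ` both `div (θ g V)` and `g ⟪V, ∇θ⟫` vanish. -/
theorem c1Cone_divergence_smul_smul_of_notMem {θ g : E³ → ℝ} {V : E³ → E³} {x : E³}
    (hx : x ∉ tsupport θ) :
    VectorCalculus.divergence (fun y => θ y • (g y • V y)) x =
      g x * inner ℝ (V x) (gradient θ x) := by
  rw [gradient_eq_zero_of_notMem_tsupport hx, inner_zero_right, mul_zero]
  exact divergence_eq_zero_of_notMem_tsupport fun h => hx (tsupport_smul_subset_left _ _ h)

/-! ### Weak divergence-freeness of `g V` off the origin -/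

/-- If `V` and `g` are `C¹` off the origin with `div V = 0` and `Dg(V) = 0` there, then `g V` is
weakly divergence-free off the origin: `∫ g ⟪V, ∇θ⟫ = 0` for every test function `θ` supported
off the origin. Proof: the whole-space divergence theorem for the `C¹` compactly supported field
`θ g V`, whose divergence is `g ⟪V, ∇θ⟫` everywhere. -/
theorem c1Cone_integral_mul_inner_gradient_eq_zero {V : E³ → E³} {g : E³ → ℝ}
    (hV : ∀ x : E³, x ≠ 0 → ContDiffAt ℝ 1 V x) (hg : ∀ x : E³, x ≠ 0 → ContDiffAt ℝ 1 g x)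
    (hdiv : ∀ x : E³, x ≠ 0 → VectorCalculus.divergence V x = 0)
    (hgV : ∀ x : E³, x ≠ 0 → fderiv ℝ g x (V x) = 0) {θ : E³ → ℝ}
    (hθ : IsTestFunctionOn ⟨{x : E³ | x ≠ 0}, isOpen_ne⟩ θ) :
    ∫ x, g x * inner ℝ (V x) (gradient θ x) = 0 := by
  have hw : ContDiff ℝ 1 fun y => θ y • (g y • V y) :=
    c1Cone_contDiff_smul hθ fun x hx => (hg x hx).fun_smul (hV x hx)
  have hc : HasCompactSupport fun y => θ y • (g y • V y) :=
    hθ.hasCompactSupport.smul_right (f' := fun y => g y • V y)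
  rw [← integral_divergence_eq_zero hw hc]
  refine integral_congr_ae (Eventually.of_forall fun x => ?_)
  by_cases hx : x ∈ tsupport θ
  · have hx0 : x ≠ 0 := hθ.tsupport_subset hx
    have hθ1 : ContDiff ℝ 1 θ := hθ.contDiff.of_le (by exact_mod_cast le_top)
    exact (c1Cone_divergence_smul_smul (hθ1.differentiable one_ne_zero x)
      ((hg x hx0).differentiableAt one_ne_zero) ((hV x hx0).differentiableAt one_ne_zero)
      (hdiv x hx0) (hgV x hx0)).symm
  · exact (c1Cone_divergence_smul_smul_of_notMem hx).symm

/-! ### Bernoulli along streamlines -/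

/-- **Bernoulli.** Where `V`, `P` are differentiable and the steady Euler momentum equation
`(V·∇)V + ∇P = 0` holds, the head `H = ½|V|² + P` has zero derivative along `V`:
`DH(x)(V x) = ⟪V, DV(V)⟫ + ⟪V, ∇P⟫ = ⟪V, (V·∇)V + ∇P⟫ = 0`. -/
theorem c1Cone_fderiv_head_apply_self {V : E³ → E³} {P : E³ → ℝ} {x : E³}
    (hV : DifferentiableAt ℝ V x) (hP : DifferentiableAt ℝ P x)
    (hE : convect V V x + gradient P x = 0) :
    fderiv ℝ (fun y => ‖V y‖ ^ 2 / 2 + P y) x (V x) = 0 := by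
  have h1 : HasFDerivAt (fun y => ‖V y‖ ^ 2) (2 • (innerSL ℝ (V x)).comp (fderiv ℝ V x)) x :=
    hV.hasFDerivAt.norm_sq
  have h2 : HasFDerivAt (fun y => ‖V y‖ ^ 2 / 2 + P y)
      ((2⁻¹ : ℝ) • (2 • (innerSL ℝ (V x)).comp (fderiv ℝ V x)) + fderiv ℝ P x) x := by
    have hfun : (fun y => ‖V y‖ ^ 2 / 2 + P y) = fun y => 2⁻¹ * ‖V y‖ ^ 2 + P y := by
      funext y
      ring
    rw [hfun]
    exact (h1.const_mul (2⁻¹ : ℝ)).fun_add hP.hasFDerivAt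
  have hP' : fderiv ℝ P x (V x) = inner ℝ (V x) (gradient P x) :=
    (radialFlux_inner_gradient P x (V x)).symm
  have hE' : fderiv ℝ V x (V x) + gradient P x = 0 := hE
  rw [h2.fderiv, add_apply, smul_apply, smul_apply, ContinuousLinearMap.comp_apply,
    innerSL_apply_apply, hP', nsmul_eq_mul, Nat.cast_ofNat, smul_eq_mul, ← mul_assoc,
    inv_mul_cancel₀ (two_ne_zero' ℝ), one_mul, ← inner_add_right, hE', inner_zero_right]

/-! ### Renormalisation of the head for `C¹` classical solutions -/

/-- **The head of a `C¹` classical steady Euler flow off the origin is renormalised**: for every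
`C¹` function `β : ℝ → ℝ` and every test function `θ` supported off the origin,
`∫ β(½|V|² + P) ⟪V, ∇θ⟫ = 0` (chain rule `D(β∘H)(V) = β'(H) DH(V) = 0` by Bernoulli, then
`c1Cone_integral_mul_inner_gradient_eq_zero`). -/
theorem c1Cone_renormalised {V : E³ → E³} {P : E³ → ℝ}
    (hV : ContDiffOn ℝ 1 V {x : E³ | x ≠ 0}) (hP : ContDiffOn ℝ 1 P {x : E³ | x ≠ 0})
    (hE : ∀ x : E³, x ≠ 0 → convect V V x + gradient P x = 0)
    (hdiv : ∀ x : E³, x ≠ 0 → VectorCalculus.divergence V x = 0) {β : ℝ → ℝ}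
    (hβ : ContDiff ℝ 1 β) {θ : E³ → ℝ} (hθ : IsTestFunctionOn ⟨{x : E³ | x ≠ 0}, isOpen_ne⟩ θ) :
    ∫ x, β (‖V x‖ ^ 2 / 2 + P x) * inner ℝ (V x) (gradient θ x) = 0 := by
  have hVx : ∀ x : E³, x ≠ 0 → ContDiffAt ℝ 1 V x := fun x hx =>
    hV.contDiffAt (isOpen_ne.mem_nhds hx)
  have hPx : ∀ x : E³, x ≠ 0 → ContDiffAt ℝ 1 P x := fun x hx =>
    hP.contDiffAt (isOpen_ne.mem_nhds hx)
  have hHx : ∀ x : E³, x ≠ 0 → ContDiffAt ℝ 1 (fun y => ‖V y‖ ^ 2 / 2 + P y) x := fun x hx =>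
    (((hVx x hx).norm_sq ℝ).div_const 2).add (hPx x hx)
  refine c1Cone_integral_mul_inner_gradient_eq_zero (g := fun y => β (‖V y‖ ^ 2 / 2 + P y)) hVx
    (fun x hx => hβ.contDiffAt.comp x (hHx x hx)) hdiv (fun x hx => ?_) hθ
  have hc : HasFDerivAt (fun y => β (‖V y‖ ^ 2 / 2 + P y))
      ((fderiv ℝ β (‖V x‖ ^ 2 / 2 + P x)).comp (fderiv ℝ (fun y => ‖V y‖ ^ 2 / 2 + P y) x)) x :=
    (hβ.differentiable one_ne_zero _).hasFDerivAt.comp x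
      ((hHx x hx).differentiableAt one_ne_zero).hasFDerivAt
  rw [hc.fderiv, ContinuousLinearMap.comp_apply,
    c1Cone_fderiv_head_apply_self ((hVx x hx).differentiableAt one_ne_zero)
      ((hPx x hx).differentiableAt one_ne_zero) (hE x hx), map_zero]

/-! ### The stub -/

/-- **Stub `stub_c1ConeFluxless`** (`C¹` DSS Euler cones are fluxless; Shvydkoy, Trans. AMS 370
(2018), Lemma 6.1, in `(-2/3, -4/3)`-discretely-self-similar generality). A velocity–pressure pair
that is `C¹` off the origin, DSS with factor `λ > 1`, and solves the steady Euler system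
classically off the origin has zero radial energy-flux log-mean
`∫_{1<|x|<λ} (½|V|² + P) ⟪V,x⟫/|x|²`. Proof: continuity off the origin gives measurability
(`{0}` is Lebesgue-null), local integrability of `|V|²` and `P` off the origin and integrability
of the flux density on the compact shell `{1 ≤ |x| ≤ λ}`; Bernoulli makes the head renormalised
(`c1Cone_renormalised`); then the landed DSS flux rigidity `stub_dssFluxRigidity`. -/
theorem stub_c1ConeFluxless :
    ∀ (lam : ℝ) (V : EuclideanSpace ℝ (Fin 3) → EuclideanSpace ℝ (Fin 3)) (P : EuclideanSpace ℝ (Fin 3) → ℝ), 1 < lam → ContDiffOn ℝ 1 V {x : EuclideanSpace ℝ (Fin 3) | x ≠ 0} → ContDiffOn ℝ 1 P {x : EuclideanSpace ℝ (Fin 3) | x ≠ 0} → (∀ x : EuclideanSpace ℝ (Fin 3), x ≠ 0 → V (lam • x) = lam ^ (-(2 / 3 : ℝ)) • V x) → (∀ x : EuclideanSpace ℝ (Fin 3), x ≠ 0 → P (lam • x) = lam ^ (-(4 / 3 : ℝ)) * P x) → (∀ x : EuclideanSpace ℝ (Fin 3), x ≠ 0 → Literature.Analysis.FluidPDE.convect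 V V x + gradient P x = 0) → (∀ x : EuclideanSpace ℝ (Fin 3), x ≠ 0 → Literature.Analysis.FluidPDE.VectorCalculus.divergence V x = 0) → ∫ x in {x : EuclideanSpace ℝ (Fin 3) | 1 < ‖x‖ ∧ ‖x‖ < lam}, (‖V x‖ ^ 2 / 2 + P x) * (inner ℝ (V x) x / ‖x‖ ^ 2) = 0 := by
  intro lam V P hlam hV hP hVss hPss hE hdiv
  have hU : MeasurableSet {x : E³ | x ≠ 0} := isOpen_ne.measurableSet
  have hVc : ContinuousOn V {x : E³ | x ≠ 0} := hV.continuousOn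
  have hPc : ContinuousOn P {x : E³ | x ≠ 0} := hP.continuousOn
  -- (a) measurability: `V` is continuous off the Lebesgue-null origin
  have hVm : AEStronglyMeasurable V volume := by
    have h := hVc.aestronglyMeasurable (μ := volume) hU
    rwa [show {x : E³ | x ≠ 0} = {0}ᶜ from rfl, restrict_compl_singleton] at h
  -- (b) local integrability off the origin
  have hVloc : LocallyIntegrableOn (fun x => ‖V x‖ ^ 2) {x : E³ | x ≠ 0} volume :=
    (hVc.norm.pow 2).locallyIntegrableOn hU
  have hPloc : LocallyIntegrableOn P {x : E³ | x ≠ 0} volume := hPc.locallyIntegrableOn hU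
  -- (c) the flux density is continuous on the compact closed shell, which avoids the origin
  have hflux : IntegrableOn (fun x => (‖V x‖ ^ 2 / 2 + P x) * (inner ℝ (V x) x / ‖x‖ ^ 2))
      {x : E³ | 1 < ‖x‖ ∧ ‖x‖ < lam} volume := by
    have hK0 : {x : E³ | 1 ≤ ‖x‖ ∧ ‖x‖ ≤ lam} ⊆ {x : E³ | x ≠ 0} := fun x hx h0 => by
      rw [h0] at hx
      norm_num at hx
    have hVK := hVc.mono hK0
    have hPK := hPc.mono hK0
    refine (ContinuousOn.integrableOn_compact (radialFlux_isCompact_shell 1 lam) ?_).mono_set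
      fun x hx => ⟨hx.1.le, hx.2.le⟩
    exact (((hVK.norm.pow 2).div_const 2).add hPK).mul ((hVK.inner continuousOn_id).div
      ((continuous_norm.pow 2).continuousOn) fun x hx =>
        pow_ne_zero 2 (zero_lt_one.trans_le hx.1).ne')
  -- (d) renormalisation of the head (Bernoulli + whole-space divergence theorem), then D1
  exact stub_dssFluxRigidity lam V P hlam hVm hVss hPss hVloc hPloc
    (fun β hβ _ _ θ hθ => c1Cone_renormalised hV hP hE hdiv hβ hθ) hflux

end Summit.AnomalousDissipation.AnomalousDissipation.Theorems

end
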